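import Summits.NavierStokesRegularity.NavierStokesRegularity.Theses.RecurrentProfiles
import Summits.NavierStokesRegularity.NavierStokesRegularity.Theorems.RecurrentProfilesRecurrentReductionOrbit
import Literature.Analysis.FluidPDE.ScalingRecurrentSlabField

/-!
# Route RecurrentProfiles — item `RecurrentReduction` (stmt-NavierStokesRegularity-1590)

`recurrentReduction_proof : RecurrentReduction` — the REDUCTION TO UNIFORMLY RECURRENT PROFILES
(card X1 of route RecurrentProfiles): if a suitable weak solution `(u, p)` of Navier–Stokes
(`ν = 1`, `f = 0`) on the backward slab `ℝ³ × ℝ₋` with weak gradient `G`, Albritton–Barker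
quantity `𝐈(ℝ³ × ℝ₋) < ∞` and the Type-I rate `‖u(t, x)‖ ≤ C/√(−t)` has a backward-singular
origin, then some profile of the same class (same `C`) is singular at the origin AND uniformly
recurrent under the Navier–Stokes scaling `σ ↦ u_{e^σ}` in `L³_loc({t ≤ 0} × ℝ³)` (Birkhoff almost
periodicity: the `ε`-return log-scales on every compact `K` are relatively dense).

Proof (Birkhoff–Furstenberg in the Albritton–Barker class; all analysis is the tree's):

* MODEL.  The `L³_loc` slab-field space `Literature.Analysis.FluidPDE.SlabField ℝ³ ℝ³ 3` (fields
  lying in `L³(Q(0, R))` for every `R`, with the Fréchet topology of the seminorms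
  `‖·‖_{L³(Q(0, n+1))}` — pseudo-metrisable, convergence = convergence in every `L³(Q(0, R))`)
  and its scaling flow `SlabField.flow σ w = w_{e^σ}`, an action by continuous maps.
* ORBIT CLOSURE.  `S` = closure of the orbit of `u`.  It is invariant and compact
  (`SlabField.isCompact_closure_orbit`): every sequence of orbit points subconverges
  (`exists_orbit_limit`, i.e. the tree's engine `slab_typeI_compactness` = Albritton–Barker 2019,
  Lemma 2.2 on the exhausting balls).
* BIRKHOFF.  `S` carries a uniformly recurrent point `a` (Furstenberg 1981, Thm. 1.16), whose
  field is uniformly recurrent under scaling (the dictionary `SlabField.isUniformlyRecurrentPt_iff`;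
  both packaged as `SlabField.exists_isScalingUniformlyRecurrent_mem_closure_orbit`).
* IDENTIFICATION.  `a` is a limit of orbit points, hence a.e. equal on the slab (uniqueness of
  `L³_loc` limits, `SlabField.ae_eq_of_tendsto`) to an engine limit of the same orbit sequence: a
  suitable weak solution with a weak gradient, `𝐈 ≤ 4 𝐈(u) < ∞`, singular at the origin by
  PERSISTENCE OF SINGULARITIES (A–B Prop. 2.3 — every orbit point is singular at the origin, so the
  engine's persistence clause fires), and with the rate almost everywhere.  Recurrence, suitability,
  `𝐈` and the singular origin do not see null sets of the slab
  (`IsScalingUniformlyRecurrent.congr_ae`, `exists_rate_profile_repr`), and the last also makes the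
  rate pointwise.

## References

* H. Furstenberg, *Recurrence in Ergodic Theory and Combinatorial Number Theory*, Princeton UP
  (1981), Ch. 1 §4, Thms. 1.15–1.16. [Furstenberg1981]
* D. Albritton, T. Barker, J. Math. Fluid Mech. 21 (2019), no. 43 = arXiv:1811.00502, Lemma 2.2,
  Prop. 2.3, §3. [AlbrittonBarker2019]
* G. Koch, N. Nadirashvili, G. Seregin, V. Šverák, Acta Math. 203 (2009), (1.4). [KNSS2009]
-/

noncomputable section

-- the sub-problem namespace repeats the summit name (D-0017 layout `Summit.<S>.<P>.Theorems`)
set_option linter.dupNamespace false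

namespace Summit.NavierStokesRegularity.NavierStokesRegularity.Theorems

open MeasureTheory Set Function Filter Topology TopologicalSpace Metric
open Literature.Analysis.FluidPDE
open Summit.NavierStokesRegularity.NavierStokesRegularity.Theses.RecurrentProfiles
open scoped NNReal ENNReal

/-! ### The reduction to uniformly recurrent profiles -/

/-- **Reduction to uniformly recurrent profiles** (route RecurrentProfiles, item
`RecurrentReduction`, card X1; Birkhoff–Furstenberg minimal-set argument in the Albritton–Barker
class).  If a suitable weak solution `(u, p)` of Navier–Stokes (`ν = 1`, `f = 0`) on `ℝ³ × ℝ₋`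
with weak gradient `G`, `𝐈(ℝ³ × ℝ₋) < ∞` and the Type-I rate `‖u(t,x)‖ ≤ C/√(−t)` has a
backward-singular origin, then some profile of the same class (same `C`) is singular at the origin
AND uniformly recurrent under the scaling `σ ↦ u_{e^σ}` in `L³_loc` of `{t ≤ 0} × ℝ³`.
Proof.  MODEL: the `L³_loc` slab-field space `SlabField ℝ³ ℝ³ 3` (Fréchet topology of the
seminorms `L³(Q(0, n+1))`, pseudo-metrisable) with its scaling flow `SlabField.flow σ w = w_{e^σ}`
acting by continuous maps.  ORBIT CLOSURE: `S` = closure of the orbit of `u`; invariant and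
compact, since every sequence of orbit points subconverges (`exists_orbit_limit` = the tree's
engine `slab_typeI_compactness`, A–B Lemma 2.2 on exhausting balls;
`SlabField.isCompact_closure_orbit`).  BIRKHOFF: `S` carries a uniformly recurrent point `a`
(Furstenberg 1981 Thm 1.16), whose field is uniformly recurrent under scaling (dictionary
`SlabField.isUniformlyRecurrentPt_iff`; `SlabField.exists_isScalingUniformlyRecurrent_mem_closure_orbit`).
IDENTIFICATION: `a` is a limit of orbit points, hence (uniqueness of `L³_loc` limits,
`SlabField.ae_eq_of_tendsto`) a.e. equal on the slab to an engine limit — a suitable weak solution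
with `𝐈 ≤ 4 𝐈(u)`, singular at the origin by persistence of singularities (A–B Prop. 2.3: every
orbit point is singular), with the rate a.e.; recurrence, suitability, `𝐈` and the singular origin
do not see null sets, and the rate is made pointwise by `exists_rate_profile_repr`.
[cite: Furstenberg1981, Ch. 1 §4, Thm. 1.16; AlbrittonBarker2019, Lemma 2.2, Prop. 2.3] -/
theorem recurrentReduction_proof : RecurrentReduction := by
  intro u p G C hsw hwg hI hdec hsing
  classical
  haveI h13 : Fact (1 ≤ (3 : ℝ≥0∞)) := ⟨by norm_num⟩
  -- `0 ≤ C`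
  have hC0 : 0 ≤ C := by
    have h := hdec (-1) (by norm_num) 0
    have h1 : (0 : ℝ) ≤ C / Real.sqrt (-(-1 : ℝ)) := (norm_nonneg _).trans h
    rw [neg_neg, Real.sqrt_one, div_one] at h1
    exact h1
  -- ## the model: `u` as a point of the `L³_loc` slab-field space `SlabField ℝ³ ℝ³ 3`
  let x₀ : SlabField (EuclideanSpace ℝ (Fin 3)) (EuclideanSpace ℝ (Fin 3)) 3 :=
    SlabField.ofMemLp u fun R hR => memLp_three_of_slabProfile hwg hI hR
  -- ## KEY: subsequential limits of orbit sequences (the engine)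
  have hkey : ∀ σs : ℕ → ℝ,
      ∃ (a : SlabField (EuclideanSpace ℝ (Fin 3)) (EuclideanSpace ℝ (Fin 3)) 3) (ψ : ℕ → ℕ),
      StrictMono ψ ∧ Tendsto (fun j => SlabField.flow (σs (ψ j)) x₀) atTop (𝓝 a) ∧
      ∃ (q : ℝ → EuclideanSpace ℝ (Fin 3) → ℝ)
        (H : ℝ → EuclideanSpace ℝ (Fin 3) → EuclideanSpace ℝ (Fin 3) →L[ℝ] EuclideanSpace ℝ (Fin 3)),
        IsSuitableWeakSolutionOn (slab (EuclideanSpace ℝ (Fin 3)) (Iio 0) isOpen_Iio) 1 0 a.toFun q ∧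
        HasWeakSpatialGradientOn (slab (EuclideanSpace ℝ (Fin 3)) (Iio 0) isOpen_Iio) a.toFun H ∧
        typeIBound (Iio (0 : ℝ) ×ˢ univ) a.toFun q H < ⊤ ∧ IsBackwardSingularPoint a.toFun 0 ∧
        (∀ᵐ z ∂(volume.restrict (Iio (0 : ℝ) ×ˢ (univ : Set (EuclideanSpace ℝ (Fin 3))))),
          ‖a.toFun z.1 z.2‖ ≤ C / Real.sqrt (-z.1)) := by
    intro σs
    obtain ⟨u', p', H', ψ, hψ, hsw', hwg', hI', hsing', hrate', hconv'⟩ :=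
      exists_orbit_limit hsw hwg hI hsing hdec (fun k => Real.exp (σs k)) (fun k => Real.exp_pos _)
    have hI'' : typeIBound (Iio (0 : ℝ) ×ˢ univ) u' p' H' < ⊤ :=
      lt_of_le_of_lt hI' (ENNReal.mul_lt_top (by simp) hI)
    refine ⟨SlabField.ofMemLp u' fun R hR => memLp_three_of_slabProfile hwg' hI'' hR, ψ, hψ, ?_,
      p', H', hsw', hwg', hI'', hsing', hrate'⟩
    rw [SlabField.tendsto_flow_iff_forall]
    exact hconv'
  -- ## compactness of the orbit closure (Albritton–Barker compactness fed to the model)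
  have hScpt : IsCompact (closure (range fun σ => SlabField.flow σ x₀)) :=
    x₀.isCompact_closure_orbit fun σs => by
      obtain ⟨a, ψ, hψ, ha, -⟩ := hkey σs
      exact ⟨a, ψ, hψ, ha⟩
  -- ## Birkhoff + dictionary: a profile of the hull uniformly recurrent under scaling
  obtain ⟨a, haS, hrecF⟩ := x₀.exists_isScalingUniformlyRecurrent_mem_closure_orbit hScpt
  -- ## identification of `a` with an engine limit, up to a null set of the slab
  obtain ⟨xs, hxs, hxa⟩ := mem_closure_iff_seq_limit.1 haS
  choose σs hσs using hxs
  obtain ⟨b, ψ, hψ, hb, q, H, hswb, hwgb, hIb, hsingb, hrateb⟩ := hkey σs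
  have hxa' : Tendsto (fun j => SlabField.flow (σs (ψ j)) x₀) atTop (𝓝 a) :=
    (hxa.comp hψ.tendsto_atTop).congr fun j => (hσs (ψ j)).symm
  have hrecb : IsScalingUniformlyRecurrent b.toFun :=
    hrecF.congr_ae (SlabField.ae_eq_of_tendsto hxa' hb)
  -- ## the pointwise rate: modification on a null set of the slab
  obtain ⟨w, hbw, hsww, hwgw, hIw, hdecw, hsingw⟩ :=
    exists_rate_profile_repr hC0 hswb hwgb hIb hsingb hrateb
  exact ⟨w, q, H, hsww, hwgw, hIw, hdecw, hsingw, hrecb.congr_ae hbw⟩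


end Summit.NavierStokesRegularity.NavierStokesRegularity.Theorems
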